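import Summits.Ventures.Crystal3D.Theorems.StickyWulffConstantGenericWallFloorStackWalkKissing
import HarnessLib

/-!
# Tools for the E1-free stack ledger: one grain's kissing walk, no arrivals for non-chain frames, and the
# multiplicity-13 payer count

HONEST FRAMING. Part of the venture `Summits/Ventures/Crystal3D` (cell `crystal3d-full`), helper
`--supports` the crux `GenericWallFloor` (stmt-Ventures-19480) of `route-Ventures-StickyWulffConstant`,
registered line `WallLedgerG`, open stub `stub_twoSlabAdhesion` (general fillings).  Bricks for the kissing
(E1-free) stack ledger, mirroring `…StackLedgerTools` / `…StackWalkFrames` with `stackWalk_end_K`: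

* `grainWalk_end_K` — one grain's walker from a full ball along a steep slot ends at a ball of `X` with a
  `≤ 11`-coordinated ball within contact distance, rise `≥ 0`, displacement `≤ (8/3)(H − height)`;
* `stackWalk_end_not_high_K` / `_not_low_K` — frames in a mirror-closed family avoiding the far lattice ⇒ the
  off-rim end is not on the far sample;
* `card_le_thirteen_mul_card_image` — if `f` moves each ball of `E ⊆ X` by at most contact distance inside the
  `1`-separated `X`, then `#E ≤ 13 · #f(E)` (a fibre is a ball plus at most twelve contacts).

WHAT THIS IS NOT: not the stub; F-C1 not moved.
-/

noncomputable section

namespace Summit.Ventures.Crystal3D.Theorems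

open Summit.Ventures.Crystal3D Finset
open Literature.MathematicalPhysics.StatisticalMechanics (fccStacking)
open scoped InnerProductSpace

variable {X : Finset (EuclideanSpace ℝ (Fin 3))}

/-- **One grain's kissing walker, end to end.** -/
theorem grainWalk_end_K {δ : ℝ} (hg : KissingGap δ) (hkc : KissingClassification δ)
    (hX : ∀ p ∈ X, ∀ q ∈ X, p ≠ q → 1 ≤ dist p q)
    {z : EuclideanSpace ℝ (Fin 3)} (hz : ‖z‖ = 1) {H : ℝ} (hH : ∀ q ∈ X, ⟪q, z⟫_ℝ ≤ H)
    (A : EuclideanSpace ℝ (Fin 3) ≃ₗᵢ[ℝ] EuclideanSpace ℝ (Fin 3))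
    {p u : EuclideanSpace ℝ (Fin 3)} (hp : p ∈ X) (hfull : ∀ w ∈ fccSlots, p + A w ∈ X)
    (hu : u ∈ fccSlots) (hsteep : Real.sqrt 2 / 2 ≤ ⟪A u, z⟫_ℝ)
    {N : ℕ} (hN : 8 * (H - ⟪p + A u, z⟫_ℝ) < 3 * N) :
    walkEnd X z N (p + A u) [⟨A, u, 0⟩] ∈ X ∧
      (∃ q ∈ X, dist (walkEnd X z N (p + A u) [⟨A, u, 0⟩]) q ≤ 1 ∧ (X.filter fun q' => dist q q' = 1).card ≤ 11) ∧
      0 ≤ ⟪walkEnd X z N (p + A u) [⟨A, u, 0⟩] - (p + A u), z⟫_ℝ ∧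
      ‖walkEnd X z N (p + A u) [⟨A, u, 0⟩] - (p + A u)‖ ≤ 8 / 3 * (H - ⟪p + A u, z⟫_ℝ) := by
  have hInv := walkInv_start A hp hfull hu hsteep
  obtain ⟨hyX, hpay, hrise, hdisp, -, -⟩ := stackWalk_end_K hg hkc hX hz hH hInv hN
  unfold walkEnd
  dsimp only at hyX hpay hrise hdisp ⊢
  refine ⟨hyX, hpay, hrise, le_trans hdisp ?_⟩
  have : ⟪(walkRun X z N (p + A u, [⟨A, u, 0⟩])).1 - (p + A u), z⟫_ℝ ≤ H - ⟪p + A u, z⟫_ℝ := by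
    rw [inner_sub_left]; linarith [hH _ hyX]
  linarith

/-- **No high end for frames avoiding `A₂·Λ₀` (kissing walk).** -/
theorem stackWalk_end_not_high_K {δ : ℝ} (hg : KissingGap δ) (hkc : KissingClassification δ)
    (hX : ∀ p ∈ X, ∀ q ∈ X, p ≠ q → 1 ≤ dist p q)
    (A₂ : EuclideanSpace ℝ (Fin 3) ≃ₗᵢ[ℝ] EuclideanSpace ℝ (Fin 3)) (t₂ : EuclideanSpace ℝ (Fin 3))
    (P₂ : Finset (EuclideanSpace ℝ (Fin 3))) (R₀ h ρ : ℝ) (hρ2 : 2 ≤ ρ) (hP₂X : P₂ ⊆ X)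
    (hcell : ∀ p ∈ X, p 2 ≤ h + 2 * R₀)
    (hP₂ : ∀ p, p ∈ P₂ ↔ (p ∈ (fun q => A₂ q + t₂) '' fccStacking 1 (Real.sqrt (2 / 3)) ∧
      h + R₀ ≤ p 2 ∧ p 2 ≤ h + 2 * R₀ ∧ p 0 ^ 2 + p 1 ^ 2 ≤ ρ ^ 2))
    (𝓕 : Set (EuclideanSpace ℝ (Fin 3) ≃ₗᵢ[ℝ] EuclideanSpace ℝ (Fin 3)))
    (havoid : ∀ G ∈ 𝓕, G '' fccStacking 1 (Real.sqrt (2 / 3)) ≠ A₂ '' fccStacking 1 (Real.sqrt (2 / 3)))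
    (hclosed : ∀ G ∈ 𝓕, ∀ m : EuclideanSpace ℝ (Fin 3), ‖m‖ = 1 →
      (∀ w ∈ fccSlots, ⟪G w, m⟫_ℝ = 0 ∨ ⟪G w, m⟫_ℝ = Real.sqrt (2 / 3) ∨ ⟪G w, m⟫_ℝ = -Real.sqrt (2 / 3)) →
      ∀ G' : EuclideanSpace ℝ (Fin 3) ≃ₗᵢ[ℝ] EuclideanSpace ℝ (Fin 3),
        (∀ x, G' x = G x - (2 * ⟪G x, m⟫_ℝ) • m) → G' ∈ 𝓕)
    {z : EuclideanSpace ℝ (Fin 3)} (hz : ‖z‖ = 1) {H : ℝ} (hH : ∀ p ∈ X, ⟪p, z⟫_ℝ ≤ H)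
    {s : EuclideanSpace ℝ (Fin 3) × List WalkEntry} (hInv : WalkInv X z s) (hs𝓕 : ∀ e ∈ s.2, e.frame ∈ 𝓕)
    {N : ℕ} (hN : 8 * (H - ⟪s.1, z⟫_ℝ) < 3 * N)
    (hyr : (walkRun X z N s).1 0 ^ 2 + (walkRun X z N s).1 1 ^ 2 ≤ (ρ - 2) ^ 2) :
    (walkRun X z N s).1 2 < h + R₀ + 2 := by
  by_contra hge
  push Not at hge
  obtain ⟨hyX, -, -, -, hI, -⟩ := stackWalk_end_K hg hkc hX hz hH hInv hN
  obtain ⟨-, hS, e, rest, hstk, hC⟩ := hI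
  have hframes := walkRun_frames_mem (X := X) z 𝓕 hclosed N s hs𝓕
  have he𝓕 : e.frame ∈ 𝓕 := hframes e (by rw [hstk]; simp)
  rw [hstk] at hS
  obtain ⟨a, ha, b, hb, c, hc, hind, haX, hbX, hcX⟩ := walkCertified_three_independent hS.top.1 hC
  exact havoid e.frame he𝓕 (movedFcc_eq_of_exact_neighbours_high A₂ t₂ X P₂ R₀ h ρ hρ2 hX hP₂X hcell hP₂
    e.frame hyX hge hyr ha hb hc hind haX hbX hcX)

/-- **No low end for frames avoiding `A₁·Λ₀` (kissing walk).** -/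
theorem stackWalk_end_not_low_K {δ : ℝ} (hg : KissingGap δ) (hkc : KissingClassification δ)
    (hX : ∀ p ∈ X, ∀ q ∈ X, p ≠ q → 1 ≤ dist p q)
    (A₁ : EuclideanSpace ℝ (Fin 3) ≃ₗᵢ[ℝ] EuclideanSpace ℝ (Fin 3)) (t₁ : EuclideanSpace ℝ (Fin 3))
    (P₁ : Finset (EuclideanSpace ℝ (Fin 3))) (R₀ ρ : ℝ) (hρ2 : 2 ≤ ρ) (hP₁X : P₁ ⊆ X)
    (hcell : ∀ p ∈ X, -(2 * R₀) ≤ p 2)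
    (hP₁ : ∀ p, p ∈ P₁ ↔ (p ∈ (fun q => A₁ q + t₁) '' fccStacking 1 (Real.sqrt (2 / 3)) ∧
      -(2 * R₀) ≤ p 2 ∧ p 2 ≤ -R₀ ∧ p 0 ^ 2 + p 1 ^ 2 ≤ ρ ^ 2))
    (𝓕 : Set (EuclideanSpace ℝ (Fin 3) ≃ₗᵢ[ℝ] EuclideanSpace ℝ (Fin 3)))
    (havoid : ∀ G ∈ 𝓕, G '' fccStacking 1 (Real.sqrt (2 / 3)) ≠ A₁ '' fccStacking 1 (Real.sqrt (2 / 3)))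
    (hclosed : ∀ G ∈ 𝓕, ∀ m : EuclideanSpace ℝ (Fin 3), ‖m‖ = 1 →
      (∀ w ∈ fccSlots, ⟪G w, m⟫_ℝ = 0 ∨ ⟪G w, m⟫_ℝ = Real.sqrt (2 / 3) ∨ ⟪G w, m⟫_ℝ = -Real.sqrt (2 / 3)) →
      ∀ G' : EuclideanSpace ℝ (Fin 3) ≃ₗᵢ[ℝ] EuclideanSpace ℝ (Fin 3),
        (∀ x, G' x = G x - (2 * ⟪G x, m⟫_ℝ) • m) → G' ∈ 𝓕)
    {z : EuclideanSpace ℝ (Fin 3)} (hz : ‖z‖ = 1) {H : ℝ} (hH : ∀ p ∈ X, ⟪p, z⟫_ℝ ≤ H)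
    {s : EuclideanSpace ℝ (Fin 3) × List WalkEntry} (hInv : WalkInv X z s) (hs𝓕 : ∀ e ∈ s.2, e.frame ∈ 𝓕)
    {N : ℕ} (hN : 8 * (H - ⟪s.1, z⟫_ℝ) < 3 * N)
    (hyr : (walkRun X z N s).1 0 ^ 2 + (walkRun X z N s).1 1 ^ 2 ≤ (ρ - 2) ^ 2) :
    -R₀ - 2 < (walkRun X z N s).1 2 := by
  by_contra hle
  push Not at hle
  obtain ⟨hyX, -, -, -, hI, -⟩ := stackWalk_end_K hg hkc hX hz hH hInv hN
  obtain ⟨-, hS, e, rest, hstk, hC⟩ := hI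
  have hframes := walkRun_frames_mem (X := X) z 𝓕 hclosed N s hs𝓕
  have he𝓕 : e.frame ∈ 𝓕 := hframes e (by rw [hstk]; simp)
  rw [hstk] at hS
  obtain ⟨a, ha, b, hb, c, hc, hind, haX, hbX, hcX⟩ := walkCertified_three_independent hS.top.1 hC
  exact havoid e.frame he𝓕 (movedFcc_eq_of_exact_neighbours_low A₁ t₁ X P₁ R₀ ρ hρ2 hX hP₁X hcell hP₁
    e.frame hyX hle hyr ha hb hc hind haX hbX hcX)

/-- **Multiplicity thirteen.**  If `E ⊆ X` (`X` `1`-separated) and `f` moves every ball of `E` by at most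
contact distance to a ball of `X`, then `#E ≤ 13 · #f(E)`: a fibre of `f` consists of balls at distance `0` or
exactly `1` from its value, i.e. the value itself and at most twelve contacts. -/
theorem card_le_thirteen_mul_card_image (hX : ∀ p ∈ X, ∀ q ∈ X, p ≠ q → 1 ≤ dist p q)
    {E : Finset (EuclideanSpace ℝ (Fin 3))} (hEX : E ⊆ X) (f : EuclideanSpace ℝ (Fin 3) → EuclideanSpace ℝ (Fin 3))
    (hf : ∀ y ∈ E, f y ∈ X ∧ dist y (f y) ≤ 1) : E.card ≤ 13 * (E.image f).card := by
  classical
  rw [Finset.card_eq_sum_card_image f E]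
  have hfib : ∀ q ∈ E.image f, (E.filter fun y => f y = q).card ≤ 13 := by
    intro q hq
    obtain ⟨y₀, hy₀, rfl⟩ := Finset.mem_image.1 hq
    have hqX : f y₀ ∈ X := (hf y₀ hy₀).1
    have hsub : (E.filter fun y => f y = f y₀) ⊆ insert (f y₀) (X.filter fun q' => dist (f y₀) q' = 1) := by
      intro y hy
      obtain ⟨hyE, hyf⟩ := Finset.mem_filter.1 hy
      rw [Finset.mem_insert, Finset.mem_filter]
      by_cases heq : y = f y₀
      · exact Or.inl heq
      · right
        refine ⟨hEX hyE, ?_⟩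
        have h1 : dist y (f y) ≤ 1 := (hf y hyE).2
        rw [hyf] at h1
        have h2 : 1 ≤ dist (f y₀) y := hX _ hqX _ (hEX hyE) (Ne.symm heq)
        rw [dist_comm] at h1
        exact le_antisymm h1 h2
    calc (E.filter fun y => f y = f y₀).card
        ≤ (insert (f y₀) (X.filter fun q' => dist (f y₀) q' = 1)).card := Finset.card_le_card hsub
      _ ≤ (X.filter fun q' => dist (f y₀) q' = 1).card + 1 := Finset.card_insert_le _ _
      _ ≤ 12 + 1 := by have := card_filter_dist_eq_one_le_twelve X hX (f y₀); omega
  calc ∑ q ∈ E.image f, (E.filter fun y => f y = q).card ≤ ∑ q ∈ E.image f, 13 := Finset.sum_le_sum hfib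
    _ = 13 * (E.image f).card := by rw [Finset.sum_const, smul_eq_mul, mul_comm]

end Summit.Ventures.Crystal3D.Theorems

end
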